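import Summits.PneNP.PneNP.Theorems.ConvexRankGatesCliqueExtLowerBoundStubIntegerThresholdCircuit
import Literature.Computability.Complexity.CircuitClassesProofs
import Literature.Computability.Complexity.CircuitLowerBoundsProofs
import Summits.PneNP.PneNP.Theorems.KarlinRubinMonotoneSufficesRoomStars

/-!
# Crux `MonotoneSuffices` (stmt-PneNP-18026), the ROOM theorem — part 3:
# the guess-and-verify detector is a small monotone circuit

For every `n, t, θ` with `t ≤ n` there is a circuit over `{∧₂, ∨₂, 0, 1}` on the edges of `Kₙ` with at most
`C(n,t) · (n (t+1) + 60 (n+3)^4 + 1)` gates computing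
`D x = [∃ T, #T = t, θ ≤ #{u ∉ T : x ≡ 1 on star T u}]` (`exists_detector_circuit`).
Three layers, assembled with the `CktSize` calculus: the `C(n,t) · n` ANDs of the stars (`cktSize_starAnd`,
`t + 1` gates each), one monotone counting threshold `[θ ≤ ·]` per `t`-set
(`stub_integerThresholdCircuit` with unit weights, `60 (n+3)^4` gates), and an OR over the `t`-sets
(a chain of `∨₂`'s, inlined; the same ten lines as `ParityLifting.cktSize_exists`, whose module is not
imported here to keep the import closure small).
No probability here.
-/

set_option linter.dupNamespace false -- `Summit.PneNP.PneNP.…`: summit = sub-problem name (D-0017 single-conjunct layout)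

namespace Summit.PneNP.PneNP.Theorems.MonotoneSuffices.Room

open Finset Literature.Computability.Complexity
open Summit.PneNP.PneNP.Theorems.CliqueExtLowerBound.WidthThreshold.ThresholdCircuit (stub_integerThresholdCircuit)

variable {n : ℕ}

/-! ### Layer 1: the ANDs of the stars -/

/-- The indicator `[u ∉ T ∧ x ≡ 1 on star T u]` costs at most `#T + 1` gates over `{∧₂, ∨₂, 0, 1}`
(a chain of `∧₂`'s over the `#T` star edges, or a constant). [folklore] -/
theorem cktSize_starAnd (T : Finset (Fin n)) (u : Fin n) :
    CktSize monotoneBasis01 (fun (x : (⊤ : SimpleGraph (Fin n)).edgeSet → Bool) (_ : Unit) =>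
      decide (u ∉ T ∧ ∀ e ∈ (univ.filter fun e : (⊤ : SimpleGraph (Fin n)).edgeSet =>
        ∃ w ∈ T, (e : Sym2 (Fin n)) = s(u, w)), x e = true)) (#T + 1) := by
  classical
  by_cases hu : u ∈ T
  · refine ((cktSize_const_mono01 _ false).of_le (by omega)).congr fun x _ => ?_
    simp [hu]
  · by_cases hS0 : (univ.filter fun e : (⊤ : SimpleGraph (Fin n)).edgeSet =>
        ∃ w ∈ T, (e : Sym2 (Fin n)) = s(u, w)) = ∅
    · refine ((cktSize_const_mono01 _ true).of_le (by omega)).congr fun x _ => ?_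
      rw [hS0]
      simp [hu]
    · have hne : (univ.filter fun e : (⊤ : SimpleGraph (Fin n)).edgeSet =>
          ∃ w ∈ T, (e : Sym2 (Fin n)) = s(u, w)).toList ≠ [] := by
        rwa [Ne, Finset.toList_eq_nil]
      have h := (cktSize_all _ hne).basis_mono monotoneBasis_subset_monotoneBasis01
      rw [Finset.length_toList, card_star T hu] at h
      refine (h.of_le (by omega)).congr fun x _ => ?_
      apply Bool.eq_iff_iff.2
      simp only [List.all_eq_true, Finset.mem_toList, decide_eq_true_eq]
      exact ⟨fun h => ⟨hu, h⟩, fun h => h.2⟩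

/-! ### Layer 2 and assembly -/

/-- A unit-weight sum of the indicators `[j ∉ T ∧ Q j]` is the filter cardinality `#{j ∉ T : Q j}`.
[folklore] -/
theorem sum_indicator_eq_card (T : Finset (Fin n)) (Q : Fin n → Prop) [DecidablePred Q] :
    ∑ j : Fin n, (1 * if decide (j ∉ T ∧ Q j) = true then 1 else 0) = #((univ \ T).filter Q) := by
  have h1 : ∀ j : Fin n, (1 * if decide (j ∉ T ∧ Q j) = true then 1 else 0) =
      if (j ∉ T ∧ Q j) then 1 else 0 := fun j => by
    rw [one_mul]
    by_cases h : j ∉ T ∧ Q j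
    · rw [if_pos h, if_pos (decide_eq_true h)]
    · rw [if_neg h, if_neg (by rw [decide_eq_true_eq]; exact h)]
  rw [sum_congr rfl fun j _ => h1 j, sum_boole, Nat.cast_id]
  congr 1
  ext j
  simp [mem_sdiff]

/-- **The detector circuit.** For `t ≤ n` and any `θ`, the guess-and-verify test
`D x = [∃ T, #T = t, θ ≤ #{u ∉ T : x ≡ 1 on star T u}]` on the edges of `Kₙ` has a circuit over
`{∧₂, ∨₂, 0, 1}` with at most `C(n,t) · (n (t+1) + 60 (n+3)^4 + 1)` gates. [folklore] -/
theorem exists_detector_circuit (n t θ : ℕ) (htn : t ≤ n) :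
    ∃ C : Circuit ((⊤ : SimpleGraph (Fin n)).edgeSet), C.IsOver monotoneBasis01 ∧
      C.size ≤ n.choose t * (n * (t + 1) + 60 * (n + 3) ^ 4 + 1) ∧
      ∀ x, C.eval x = decide (∃ T ∈ powersetCard t (univ : Finset (Fin n)),
        θ ≤ #((univ \ T).filter fun u => ∀ e ∈ (univ.filter fun e : (⊤ : SimpleGraph (Fin n)).edgeSet =>
          ∃ w ∈ T, (e : Sym2 (Fin n)) = s(u, w)), x e = true)) := by
  classical
  haveI : Nonempty (powersetCard t (univ : Finset (Fin n))) := by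
    obtain ⟨T, hT⟩ := (powersetCard_nonempty (s := (univ : Finset (Fin n))) (n := t)).2
      (by rw [card_univ, Fintype.card_fin]; exact htn)
    exact ⟨⟨T, hT⟩⟩
  -- layer 1: all the star ANDs
  have hA : CktSize monotoneBasis01 (fun (x : (⊤ : SimpleGraph (Fin n)).edgeSet → Bool)
      (p : powersetCard t (univ : Finset (Fin n)) × Fin n) =>
      decide (p.2 ∉ p.1.1 ∧ ∀ e ∈ (univ.filter fun e : (⊤ : SimpleGraph (Fin n)).edgeSet =>
        ∃ w ∈ p.1.1, (e : Sym2 (Fin n)) = s(p.2, w)), x e = true))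
      (Fintype.card (powersetCard t (univ : Finset (Fin n)) × Fin n) * (t + 1)) :=
    CktSize.pi_const fun p => by
      have h := cktSize_starAnd p.1.1 p.2
      rw [(mem_powersetCard.1 p.1.2).2] at h
      exact h
  -- layer 2: one counting threshold per `T`
  have hB : CktSize monotoneBasis01 (fun (y : powersetCard t (univ : Finset (Fin n)) × Fin n → Bool)
      (T : powersetCard t (univ : Finset (Fin n))) =>
      decide (θ ≤ ∑ j : Fin n, (1 * if y (T, j) then 1 else 0)))
      (Fintype.card (powersetCard t (univ : Finset (Fin n))) * (60 * (n + 3) ^ 4)) :=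
    CktSize.pi_const fun T => by
      obtain ⟨Ψ, hΨB, hΨs, hΨe⟩ := stub_integerThresholdCircuit n 1 (fun _ => 1) θ (fun _ => by norm_num)
      have e3 : 60 * (n + 1 + 2) ^ 4 = 60 * (n + 3) ^ 4 := by ring
      have h := ((Ψ.cktSize_eval hΨB).rewire
        (ι' := powersetCard t (univ : Finset (Fin n)) × Fin n) fun j => (T, j)).of_le
        (hΨs.trans e3.le)
      refine h.congr fun y _ => ?_
      rw [hΨe]
  -- layer 3: the OR over the `t`-sets (a chain of `∨₂`'s; cf. `ParityLifting.cktSize_exists`)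
  have hC : CktSize monotoneBasis01 (fun (z : powersetCard t (univ : Finset (Fin n)) → Bool) (_ : Unit) =>
      decide (∃ k, z k = true)) (Fintype.card (powersetCard t (univ : Finset (Fin n)))) := by
    have hne : (Finset.univ : Finset (powersetCard t (univ : Finset (Fin n)))).toList ≠ [] := by
      rw [Ne, Finset.toList_eq_nil, Finset.univ_eq_empty_iff]
      exact not_isEmpty_of_nonempty _
    have h := (cktSize_any (Finset.univ : Finset (powersetCard t (univ : Finset (Fin n)))).toList hne).basis_mono
      monotoneBasis_subset_monotoneBasis01
    rw [Finset.length_toList, Finset.card_univ] at h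
    refine h.congr fun z _ => ?_
    apply Bool.eq_iff_iff.2
    rw [List.any_eq_true, decide_eq_true_iff]
    simp [Finset.mem_toList]
  have hABC := (hA.comp hB).comp hC
  have hcardT : Fintype.card (powersetCard t (univ : Finset (Fin n))) = n.choose t := by
    rw [Fintype.card_coe, card_powersetCard, card_univ, Fintype.card_fin]
  have hsize : Fintype.card (powersetCard t (univ : Finset (Fin n)) × Fin n) * (t + 1) +
      Fintype.card (powersetCard t (univ : Finset (Fin n))) * (60 * (n + 3) ^ 4) +
      Fintype.card (powersetCard t (univ : Finset (Fin n))) =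
      n.choose t * (n * (t + 1) + 60 * (n + 3) ^ 4 + 1) := by
    rw [Fintype.card_prod, Fintype.card_fin, hcardT]; ring
  obtain ⟨C, hCB, hCs, hCe⟩ := (hABC.of_le hsize.le).toCircuit
  refine ⟨C, hCB, hCs, fun x => ?_⟩
  rw [hCe]
  have hsum : ∀ T : Finset (Fin n),
      (∑ j : Fin n, (1 * if decide (j ∉ T ∧ ∀ e ∈ (univ.filter fun e : (⊤ : SimpleGraph (Fin n)).edgeSet =>
        ∃ w ∈ T, (e : Sym2 (Fin n)) = s(j, w)), x e = true) = true then 1 else 0)) =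
      #((univ \ T).filter fun u => ∀ e ∈ (univ.filter fun e : (⊤ : SimpleGraph (Fin n)).edgeSet =>
        ∃ w ∈ T, (e : Sym2 (Fin n)) = s(u, w)), x e = true) := fun T => sum_indicator_eq_card T _
  apply Bool.eq_iff_iff.2
  simp only [hsum]
  simp only [decide_eq_true_eq]
  constructor
  · rintro ⟨T, hT⟩
    exact ⟨T.1, T.2, hT⟩
  · rintro ⟨T, hTmem, hT⟩
    exact ⟨⟨T, hTmem⟩, hT⟩

end Summit.PneNP.PneNP.Theorems.MonotoneSuffices.Room

namespace Summit.PneNP.PneNP.Theorems.MonotoneSuffices.Room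

open Finset

/-- Registered sub-goal `room_circuit` of stmt-PneNP-18026 (room theorem, part 3): the detector circuit,
exported verbatim. [folklore] -/
theorem room_circuit :
    ∀ (n t θ : ℕ), t ≤ n → ∃ C : Literature.Computability.Complexity.Circuit ((⊤ : SimpleGraph (Fin n)).edgeSet), C.IsOver Literature.Computability.Complexity.monotoneBasis01 ∧ C.size ≤ n.choose t * (n * (t + 1) + 60 * (n + 3) ^ 4 + 1) ∧ ∀ x, C.eval x = decide (∃ T ∈ Finset.powersetCard t (Finset.univ : Finset (Fin n)), θ ≤ #((Finset.univ \ T).filter fun u => ∀ e ∈ (Finset.univ.filter fun e : (⊤ : SimpleGraph (Fin n)).edgeSet => ∃ w ∈ T, (e : Sym2 (Fin n)) = s(u, w)), x e = true)) :=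
  fun n t θ htn => exists_detector_circuit n t θ htn

end Summit.PneNP.PneNP.Theorems.MonotoneSuffices.Room
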